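import Literature.Analysis.FluidPDE.CaloricLocalLerayHolds
import HarnessLib

/-!
# [BT1] §4 discharged: `bradshawTsai2017_section4_holds`

Analysis/FluidPDE proof file (theorems only), sibling of `ForwardDSSLocalLeray.lean`: the
**discharge of the named fact `Literature.Analysis.FluidPDE.bradshawTsai2017_section4`**
(Bradshaw–Tsai, *Forward discretely self-similar solutions of the Navier–Stokes equations II*,
Ann. Henri Poincaré 18 (2017) [BT1], §4, proof of Thm 1.2: "We now check that `v` is a local
Leray solution to (NSE). *Locally finite energy and enstrophy* … *Convergence to initial data* …
*Decay at spatial infinity* … *Local energy inequality*"), i.e. that every ansatz pair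
`BradshawTsai2017.IsAnsatzSolution λ v₀ v π` of a divergence free `λ`-DSS datum `v₀ ∈ L³_w(ℝ³)`
is a local Leray solution `IsLocalLeraySolution 1 v₀ v π` ([BT1] Def. 1.1 = Kang–Miura–Tsai
Def. 3.2).

The proof is the composition of the two halves already in the tree:

* `bradshawTsai2017_section4_of_caloric` (`ForwardDSSLocalLerayGradient.lean`): §4 follows from
  the linear local Leray bounds of the caloric extension `e^{tΔ}v₀`
  (`bradshawTsai2017_caloric_localLeray`), clause by clause — local square integrability,
  uniformly local energy, attainment of the datum and decay at infinity by the splitting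
  `|v|² ≤ 2|v − e^{tΔ}v₀|² + 2|e^{tΔ}v₀|²` against the printed `t^{1/4}`-law
  (`ForwardDSSLocalLerayEnergy.lean`), the pressure class up to `t = 0`
  (`ForwardDSSLocalLerayPressure.lean`), the enstrophy by the DSS summation
  "`∫₀^{λ²}∫ |∇(v − e^{tΔ}v₀)|² ≲ (Σₖ λ^{-k}) ∫₁^{λ²}∫ |∇(v − e^{tΔ}v₀)|²`"
  (`ForwardDSSLocalLerayGradient.lean`);
* `bradshawTsai2017_caloric_localLeray_holds` (`CaloricLocalLerayHolds.lean`): the heat-flow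
  claims quoted in §4 ("`v₀ ∈ L²_uloc` implies `e^{tΔ}v₀` has uniformly locally finite energy and
  enstrophy", "`e^{tΔ}v₀ → v₀` in `L²_loc`", "the same decay requirements at spatial infinity"),
  proved by the truncation `L³_w ⊂ (L¹ ∩ L²) + (L⁴ ∩ L^∞)` and the `Lᵖ` theory of the heat
  kernel (Lemarié-Rieusset 2016, proof of Thm 14.1, Step 1). (An independent route to the
  enstrophy clause for all `Lᵖ` data, `2 ≤ p < ∞`, by the local energy equality of the heat
  flow, is `exists_setLIntegral_box_frobeniusNormSq_fderiv_heatExtension_le` of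
  `HeatFlowLocalEnstrophy.lean`.)

Consequently [BT1] Thm 1.2 with its `t^{1/4}`-estimate rests on the single named fact
`bradshawTsai2017_thm_2_4` ([BT1] Thm 2.4 with Lemma 3.4): `bradshawTsai2017_thm_1_2_of_thm_2_4`.

## References

* Z. Bradshaw, T.-P. Tsai, Ann. Henri Poincaré 18 (2017) 1095–1119 = arXiv:1510.07504, §1
  (Def. 1.1, Thm 1.2), §4 (proof of Thm 1.2) [BradshawTsai2017AHP].
* K. Kang, H. Miura, T.-P. Tsai, IMRN 2021, Def. 3.2 [KangMiuraTsai2020].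
* P. G. Lemarié-Rieusset, *The Navier–Stokes problem in the 21st century*, CRC Press 2016,
  Thm 14.1 (proof, Step 1) [LemarieRieusset2016].
-/

noncomputable section

open MeasureTheory Set Function Filter Topology TopologicalSpace Metric
open scoped NNReal ENNReal

namespace Literature.Analysis.FluidPDE

/-- **[BT1] §4, discharged** (Bradshaw–Tsai 2017, proof of Theorem 1.2: "We now check that `v`
is a local Leray solution to (NSE)"): for a divergence free `λ`-DSS `v₀ ∈ L³_w(ℝ³)` (`λ > 1`),
every ansatz pair `(v, π)` — the physical-variables image of a suitable periodic weak solution of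
the Leray system with profile `√(2t) e^{tΔ}v₀` — is a local Leray solution with datum `v₀`.
Composition of `bradshawTsai2017_section4_of_caloric` (the verification of the local Leray
axioms from the linear local Leray bounds of `e^{tΔ}v₀`) with the discharged heat-flow claims
`bradshawTsai2017_caloric_localLeray_holds`. [cite: BradshawTsai2017AHP, §4 (proof of Thm 1.2)] -/
theorem bradshawTsai2017_section4_holds : bradshawTsai2017_section4 :=
  bradshawTsai2017_section4_of_caloric bradshawTsai2017_caloric_localLeray_holds

/-- **[BT1] Theorem 1.2 with the `t^{1/4}`-estimate, from Theorem 2.4 alone.** Under the single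
named fact `bradshawTsai2017_thm_2_4` ([BT1] Thm 2.4 with Lemma 3.4), every divergence free
`λ`-DSS `v₀ ∈ L³_w(ℝ³)` (`λ > 1`) has a `λ`-DSS local Leray solution `(v, π)` with
`‖v(t) − e^{tΔ}v₀‖²_{L²(ℝ³)} ≤ C √t` for all `t > 0` ("Theorem 1.2. … there exists a local Leray
solution `v` to (NSE) which is `λ`-DSS and additionally satisfies
`‖v(t) − e^{tΔ}v₀‖_{L²(ℝ³)} ≤ C₀ t^{1/4}` for any `t ∈ (0,∞)`"). [cite: BradshawTsai2017AHP, Thm 1.2] -/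
theorem bradshawTsai2017_thm_1_2_of_thm_2_4 (h24 : bradshawTsai2017_thm_2_4) {c : ℝ} (hc : 1 < c)
    {v₀ : EuclideanSpace ℝ (Fin 3) → EuclideanSpace ℝ (Fin 3)}
    (hw : FunctionSpaces.MemWeakLp v₀ 3 volume) (hdiv : FluidPDE.IsWeaklyDivFree v₀)
    (hdss : FluidPDE.nsRescaleData c v₀ = v₀) :
    ∃ (v : ℝ → EuclideanSpace ℝ (Fin 3) → EuclideanSpace ℝ (Fin 3))
      (π : ℝ → EuclideanSpace ℝ (Fin 3) → ℝ), IsLocalLeraySolution 1 v₀ v π ∧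
      FluidPDE.IsDiscretelySelfSimilar c v ∧
      ∃ C : ℝ≥0, ∀ t : ℝ, 0 < t →
        ∫⁻ x, ‖v t x - UnboundedOperators.heatExtension v₀ t x‖ₑ ^ 2 ≤
          C * ENNReal.ofReal (Real.sqrt t) :=
  bradshawTsai2017_thm_1_2_of_parts h24 bradshawTsai2017_section4_holds hc hw hdiv hdss

end Literature.Analysis.FluidPDE

end
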